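import Summits.SmoothPoincare4.SmoothPoincare4.Theorems.ConvexBisectionAcyclicBisectionExistsSeamTwistSignAmbient
import Summits.SmoothPoincare4.SmoothPoincare4.Theorems.ConvexBisectionAcyclicBisectionExistsSeamTwistSignLift
import HarnessLib

/-!
# Seam transport, ST4 (4a, calculus on the boundary 3-manifold): the ambient differential of a map
# `∂ Base g → Base g` and the frame data of fibred boundary maps
(wave 5, brick X3-3b of sub-node ST4 `node_ST4_twistSign` of node T3c-2 `node_seam_transport` of
stub `stub_T3_dualPresentation` (T3), line `modp-braid-orbits`, crux
`ConvexBisection.AcyclicBisectionExists`, item stmt-SmoothPoincare4-10508; registered sub-goal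
`helper_bdDeriv_fibred`)

Companion of `…SeamTwistSignAmbient.lean` (maps `Base g → Base g`) for maps
`G : ∂ Base g → Base g` out of the boundary 3-manifold `Y = (bBase g).carrier` — the seam map
`seamB` of `…SeamTwistSignLift.lean` and its straightenings `R_1 ∘ seamB`.  The BOUNDARY AMBIENT
DIFFERENTIAL `bdDeriv g G y : ℝ⁴ →L ℝ⁴` is `d(val ∘ G)_y ∘ tail ∘ ambient_y⁻¹`: on a vector `X` of `ℝ⁴`
tangent to `∂ Base g` at `y` (`d rho (X) = 0`, i.e. `X = ambient (0, e)`) it is the ambient image of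
`dG_y e` (`bdDeriv_ambient`); it is multiplicative against maps of the base
(`bdDeriv_comp : bdDeriv (f ∘ G) = ambDeriv f ∘ bdDeriv G`).  For a FIBRED boundary map (values in
`∂ Base g`, `w ∘ G ∈ ℝ_{>0} · w` near `y`) between flat page points, `Λ = bdDeriv g G y` maps tangent
vectors of `∂ Base g` to tangent vectors of `∂ Base g`, scales the horizontal-normal component by ONE
positive factor and maps the page line `L_y` into `L_{G y}` (`helper_bdDeriv_fibred`: differentiate
`Im (w(G y') w̄(y')) ≡ 0` on the 3-manifold); and it is injective on `T ∂ Base g` when `dG_y` is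
injective (`bdDeriv_eq_zero_imp`), which holds for the seam map (`injective_mfderiv_seamB`).  These
are exactly the inputs `Λ` of the pointwise frame relation (`…SeamTwistSignFrame.lean`) and of the page
determinant (`…SeamTwistSignPageDet.lean`).

Everything is proved; no named facts, no `sorry`.  References: J. B. Etnyre, T. Fuller, IMRN 2006,
Thm. 1 (proof, p. 8) [EtnyreFuller2006]; J. M. Lee, *Introduction to Smooth Manifolds* (2013),
Prop. 3.9, Cor. 5.30 [LeeSmoothManifolds2013].
-/

noncomputable section

set_option linter.dupNamespace false

open scoped Manifold ContDiff Topology ComplexConjugate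

namespace Summit.SmoothPoincare4.SmoothPoincare4.Theorems.AcyclicBisectionExists.ModpBraidOrbits

open Set Function Filter Complex
open Literature.Topology.FourManifolds Literature.Topology.FourManifolds.HandleAttachingMap
  Literature.Topology.FourManifolds.BoundaryManifold Literature.Topology.FourManifolds.LefschetzBase
  Literature.Geometry.Symplectic

variable {g : ℕ}

/-! ## §1 The boundary ambient differential -/

/-- **The boundary ambient differential** of `G : ∂ Base g → Base g` at `y`:
`d(val ∘ G)_y ∘ tail ∘ ambient_y⁻¹ : ℝ⁴ →L ℝ⁴` (meaningful on vectors tangent to `∂ Base g` at `y`).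
[cite: LeeSmoothManifolds2013, Prop. 3.9] -/
def bdDeriv (g : ℕ) (G : (bBase g).carrier → Base g) (y : (bBase g).carrier) :
    EuclideanSpace ℝ (Fin 4) →L[ℝ] EuclideanSpace ℝ (Fin 4) :=
  (mfderiv (𝓡 3) (𝓡 4) (fun y' => ((G y').1 : EuclideanSpace ℝ (Fin 4))) y).comp
    ((tailL 3).comp (ambientEquiv g y.1).symm.toContinuousLinearMap)

/-- Unfolding the boundary ambient differential. [folklore] -/
theorem bdDeriv_apply (G : (bBase g).carrier → Base g) (y : (bBase g).carrier)
    (X : EuclideanSpace ℝ (Fin 4)) :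
    bdDeriv g G y X = mfderiv (𝓡 3) (𝓡 4) (fun y' => ((G y').1 : EuclideanSpace ℝ (Fin 4))) y
      (tail 3 ((ambientEquiv g y.1).symm X)) := rfl

/-- The inclusion `∂ Base g ↪ ℝ⁴` has differential `ambient ∘ (u ↦ (0, u))`. [folklore] -/
theorem hasMFDerivAt_val_val (y : (bBase g).carrier) :
    HasMFDerivAt (𝓡 3) (𝓡 4) (fun y' : (bBase g).carrier => ((y'.1).1 : EuclideanSpace ℝ (Fin 4))) y
      ((ambientCLM g y.1).comp (consZeroL 3)) :=
  (hasMFDerivAt_incl_base y.1).comp y (hasMFDerivAt_incl_boundaryData (n := 3) y)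

/-- **The differential of `val ∘ G` is the ambient image of `dG`.** [folklore] -/
theorem hasMFDerivAt_val_comp {G : (bBase g).carrier → Base g} {y : (bBase g).carrier}
    (hG : MDifferentiableAt (𝓡 3) (𝓡∂ 4) G y) :
    HasMFDerivAt (𝓡 3) (𝓡 4) (fun y' => ((G y').1 : EuclideanSpace ℝ (Fin 4))) y
      ((ambientCLM g (G y)).comp (mfderiv (𝓡 3) (𝓡∂ 4) G y)) :=
  (hasMFDerivAt_incl_base (G y)).comp y hG.hasMFDerivAt

/-- The differential of `val ∘ G`, `mfderiv` form. [folklore] -/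
theorem mfderiv_val_comp_apply {G : (bBase g).carrier → Base g} {y : (bBase g).carrier}
    (hG : MDifferentiableAt (𝓡 3) (𝓡∂ 4) G y) (e : EuclideanSpace ℝ (Fin 3)) :
    mfderiv (𝓡 3) (𝓡 4) (fun y' => ((G y').1 : EuclideanSpace ℝ (Fin 4))) y e =
      ambient g (G y) (mfderiv (𝓡 3) (𝓡∂ 4) G y e) := by
  rw [(hasMFDerivAt_val_comp hG).mfderiv]; rfl

/-- A vector tangent to `∂ Base g` at `y` is the ambient image of a boundary-hyperplane chart vector:
`X = ambient (0, tail (ambient⁻¹ X))`. [folklore] -/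
theorem ambient_consZeroL_tail (y : (bBase g).carrier) {X : EuclideanSpace ℝ (Fin 4)}
    (hX : fderiv ℝ (rho g) y.1.1 X = 0) :
    ambient g y.1 (consZeroL 3 (tail 3 ((ambientEquiv g y.1).symm X))) = X := by
  have h0 : (ambientEquiv g y.1).symm X 0 = 0 := by
    rw [ambientEquiv_symm_apply_zero y.1 ((RegularSublevel.mem_boundary_iff _ _).1 y.2), hX, neg_zero]
  rw [consZeroL_apply, consCLE_tail_of_eq_zero 3 h0, ambient_symm_apply]

/-- **The boundary ambient differential on tangent vectors of `∂ Base g`**: for `X = ambient (0, e)`,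
`bdDeriv G y X = ambient (dG_y e)`. [folklore] -/
theorem bdDeriv_ambient {G : (bBase g).carrier → Base g} {y : (bBase g).carrier}
    (hG : MDifferentiableAt (𝓡 3) (𝓡∂ 4) G y) (e : EuclideanSpace ℝ (Fin 3)) :
    bdDeriv g G y (ambient g y.1 (consZeroL 3 e)) = ambient g (G y) (mfderiv (𝓡 3) (𝓡∂ 4) G y e) := by
  rw [bdDeriv_apply, symm_ambient_apply, tail_consZeroL, mfderiv_val_comp_apply hG]

/-- **Multiplicativity against maps of the base**: `bdDeriv (f ∘ G) y = ambDeriv f (G y) ∘ bdDeriv G y`.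
[cite: LeeSmoothManifolds2013, Prop. 3.9] -/
theorem bdDeriv_comp {f : Base g → Base g} {G : (bBase g).carrier → Base g} {y : (bBase g).carrier}
    (hf : MDifferentiableAt (𝓡∂ 4) (𝓡∂ 4) f (G y)) (hG : MDifferentiableAt (𝓡 3) (𝓡∂ 4) G y) :
    bdDeriv g (f ∘ G) y = (ambDeriv g f (G y)).comp (bdDeriv g G y) := by
  ext1 X
  rw [ContinuousLinearMap.comp_apply, bdDeriv_apply, bdDeriv_apply,
    mfderiv_val_comp_apply (hf.comp y hG), mfderiv_val_comp_apply hG, ambDeriv_ambient,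
    mfderiv_comp y hf hG]
  rfl

/-- **Injectivity on `T ∂ Base g`**: if `dG_y` is injective then `bdDeriv G y X = 0` with `d rho (X) = 0`
forces `X = 0`. [folklore] -/
theorem bdDeriv_eq_zero_imp {G : (bBase g).carrier → Base g} {y : (bBase g).carrier}
    (hG : MDifferentiableAt (𝓡 3) (𝓡∂ 4) G y) (hinj : Injective (mfderiv (𝓡 3) (𝓡∂ 4) G y))
    {X : EuclideanSpace ℝ (Fin 4)} (hX : fderiv ℝ (rho g) y.1.1 X = 0) (h0 : bdDeriv g G y X = 0) :
    X = 0 := by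
  have hXe := ambient_consZeroL_tail y hX
  set e := tail 3 ((ambientEquiv g y.1).symm X) with he
  rw [← hXe, bdDeriv_ambient hG] at h0
  have h1 : mfderiv (𝓡 3) (𝓡∂ 4) G y e = 0 :=
    injective_ambient _ (h0.trans (map_zero _).symm)
  have h2 : e = 0 := hinj (h1.trans (map_zero _).symm)
  rw [← hXe, h2, map_zero]
  exact (ambientCLM g y.1).map_zero

/-! ## §2 The frame data of a fibred boundary map -/

/-- **`val ∘ G` maps tangent vectors to tangent vectors of `∂ Base g`** when `G` takes boundary values:
`d rho (bdDeriv G y X) = 0` for all `X`. [folklore] -/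
theorem fderiv_rho_bdDeriv {G : (bBase g).carrier → Base g} {y : (bBase g).carrier}
    (hG : MDifferentiableAt (𝓡 3) (𝓡∂ 4) G y) (hbd : ∀ y', rho g (G y').1 = 1 / 4)
    (X : EuclideanSpace ℝ (Fin 4)) : fderiv ℝ (rho g) (G y).1 (bdDeriv g G y X) = 0 := by
  set e := tail 3 ((ambientEquiv g y.1).symm X) with he
  have hdρ : HasFDerivAt (rho g) (fderiv ℝ (rho g) (G y).1) (G y).1 :=
    (((contDiff_rho g).differentiable (by simp)) _).hasFDerivAt
  have h1 : HasMFDerivAt (𝓡 3) 𝓘(ℝ, ℝ) (rho g ∘ fun y' => ((G y').1 : EuclideanSpace ℝ (Fin 4))) y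
      ((fderiv ℝ (rho g) (G y).1).comp
        ((ambientCLM g (G y)).comp (mfderiv (𝓡 3) (𝓡∂ 4) G y))) :=
    hdρ.hasMFDerivAt.comp y (hasMFDerivAt_val_comp hG)
  have hconst : (rho g ∘ fun y' => ((G y').1 : EuclideanSpace ℝ (Fin 4))) = fun _ => (1 / 4 : ℝ) :=
    funext hbd
  rw [hconst] at h1
  have h2 := (hasMFDerivAt_const (I := 𝓡 3) (I' := 𝓘(ℝ, ℝ)) (1 / 4 : ℝ) y).mfderiv.symm.trans
    h1.mfderiv
  have h3 := congrArg (fun L : EuclideanSpace ℝ (Fin 3) →L[ℝ] ℝ => L e) h2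
  rw [bdDeriv_apply, mfderiv_val_comp_apply hG]
  exact h3.symm

/-- **A direction-preserving boundary map scales the angular form by `r²`**: if
`w (G y') = r(y') w y'` (`r > 0`) near `y` then, with `w (G y) = r w y`,
`Im (w̄(G y) dw_{G y}(Λ X)) = r² Im (w̄(y) dw_y(X))` for `Λ = bdDeriv g G y` and every `X` tangent to
`∂ Base g` at `y`. [cite: EtnyreFuller2006, Thm. 1 (proof, p. 8)] -/
theorem angle_bdDeriv {G : (bBase g).carrier → Base g} {y : (bBase g).carrier}
    (hG : MDifferentiableAt (𝓡 3) (𝓡∂ 4) G y)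
    (hdir : ∀ᶠ y' in 𝓝 y, ∃ r : ℝ, 0 < r ∧ w g (G y').1 = (r : ℂ) * w g y'.1.1) :
    ∃ r : ℝ, 0 < r ∧ w g (G y).1 = (r : ℂ) * w g y.1.1 ∧
      ∀ X, fderiv ℝ (rho g) y.1.1 X = 0 →
        (conj (w g (G y).1) * (dPhiX g (G y).1 * cx (bdDeriv g G y X) +
          dPhiY (G y).1 * cy (bdDeriv g G y X))).im =
        r ^ 2 * (conj (w g y.1.1) * (dPhiX g y.1.1 * cx X + dPhiY y.1.1 * cy X)).im := by
  obtain ⟨r, hr, hrw⟩ := hdir.self_of_nhds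
  refine ⟨r, hr, hrw, fun X hX => ?_⟩
  have hXe := ambient_consZeroL_tail y hX
  set e := tail 3 ((ambientEquiv g y.1).symm X) with he
  set P : (bBase g).carrier → ℂ := fun y' => w g (G y').1 with hP
  set Q : (bBase g).carrier → ℂ := fun y' => conj (w g y'.1.1) with hQ
  have hdw : ∀ q, HasFDerivAt (w g) (fderiv ℝ (w g) q) q := fun q =>
    (((contDiff_w g).differentiable (by simp)) q).hasFDerivAt
  set P' : EuclideanSpace ℝ (Fin 3) →L[ℝ] ℂ := (fderiv ℝ (w g) (G y).1).comp
    ((ambientCLM g (G y)).comp (mfderiv (𝓡 3) (𝓡∂ 4) G y)) with hP'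
  set Q' : EuclideanSpace ℝ (Fin 3) →L[ℝ] ℂ := (Complex.conjCLE.toContinuousLinearMap.comp
    (fderiv ℝ (w g) y.1.1)).comp ((ambientCLM g y.1).comp (consZeroL 3)) with hQ'
  have hPd : HasMFDerivAt (𝓡 3) 𝓘(ℝ, ℂ) P y P' := (hdw (G y).1).hasMFDerivAt.comp y (hasMFDerivAt_val_comp hG)
  have hQd0 := (Complex.conjCLE.hasFDerivAt.comp y.1.1 (hdw y.1.1)).hasMFDerivAt.comp y
    (hasMFDerivAt_val_val y)
  have hQd : HasMFDerivAt (𝓡 3) 𝓘(ℝ, ℂ) Q y Q' := hQd0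
  have hPQ := hPd.mul hQd
  -- `Im (P Q) = 0` near `y`, so its differential at `y` vanishes
  have him0 : (fun y' => (Complex.imCLM : ℂ →L[ℝ] ℝ) ((P * Q) y')) =ᶠ[𝓝 y] fun _ => 0 := by
    filter_upwards [hdir] with y' hy'
    obtain ⟨s, _, hs⟩ := hy'
    show ((w g (G y').1) * conj (w g y'.1.1)).im = 0
    rw [hs, mul_assoc, Complex.mul_conj, Complex.mul_im, Complex.ofReal_re, Complex.ofReal_im]
    simp [Complex.normSq]
  have hIm : HasMFDerivAt (𝓡 3) 𝓘(ℝ, ℝ) (fun y' => (Complex.imCLM : ℂ →L[ℝ] ℝ) ((P * Q) y')) y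
      ((Complex.imCLM : ℂ →L[ℝ] ℝ).comp (P y • Q' + Q y • P')) :=
    Complex.imCLM.hasFDerivAt.hasMFDerivAt.comp y hPQ
  have hzero := ((hasMFDerivAt_const (I := 𝓡 3) (I' := 𝓘(ℝ, ℝ)) (0 : ℝ) y).mfderiv.symm.trans
    him0.mfderiv_eq.symm).trans hIm.mfderiv
  have key : ((P y • Q' + Q y • P') e).im = 0 := by
    have h := congrArg (fun L : EuclideanSpace ℝ (Fin 3) →L[ℝ] ℝ => L e) hzero
    exact h.symm
  have hPy : P y = (r : ℂ) * w g y.1.1 := hrw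
  have key' : ((r : ℂ) * w g y.1.1 * Q' e + conj (w g y.1.1) * P' e).im = 0 := by
    have e1 : (P y • Q' + Q y • P') e = (r : ℂ) * w g y.1.1 * Q' e + conj (w g y.1.1) * P' e := by
      rw [← hPy]; rfl
    rw [e1] at key
    exact key
  have eQ : Q' e = conj (dPhiX g y.1.1 * cx X + dPhiY y.1.1 * cy X) := by
    show conj (fderiv ℝ (w g) y.1.1 (ambient g y.1 (consZeroL 3 e))) = _
    rw [fderiv_w_apply, hXe]
  have eP : P' e = dPhiX g (G y).1 * cx (bdDeriv g G y X) + dPhiY (G y).1 * cy (bdDeriv g G y X) := by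
    show fderiv ℝ (w g) (G y).1 (ambient g (G y) (mfderiv (𝓡 3) (𝓡∂ 4) G y e)) = _
    rw [fderiv_w_apply, ← bdDeriv_ambient hG, hXe]
  rw [eQ, eP] at key'
  rw [hrw]
  exact im_conj_mul_aux key'

/-- **Sub-goal `helper_bdDeriv_fibred` of stub `stub_T3_dualPresentation`** (T3 ▸ T3c-2 ▸ ST4
`node_ST4_twistSign`, brick X3-3b; wave 5, lead c5): **the frame data of a fibred boundary map.**  Let
`G : ∂ Base g → Base g` be differentiable at `y`, take values in `∂ Base g` (`rho ∘ G = 1/4`) and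
preserve the direction of `w` near `y` (`w (G y') = r(y') w y'`, `r(y') > 0`); let `y` and `G y` be flat
page points.  Then for `Λ = bdDeriv g G y` and vectors `X` of `ℝ⁴` tangent to `∂ Base g` at `y`
(`d rho_y X = 0`): (i) `d rho_{G y} (Λ X) = 0`; (ii) `⟪Λ X, n(G y)⟫ = κ ⟪X, n(y)⟫` with ONE `κ > 0`;
(iii) `Λ` maps the page line `L_y = ker dΦ_y` into `L_{G y}`. [cite: EtnyreFuller2006, Thm. 1 (proof, p. 8)] -/
theorem helper_bdDeriv_fibred : ∀ (g : ℕ) (G : (Literature.Topology.FourManifolds.LefschetzBase.bBase g).carrier → Literature.Topology.FourManifolds.LefschetzBase.Base g) (y : (Literature.Topology.FourManifolds.LefschetzBase.bBase g).carrier), MDifferentiableAt (𝓡 3) (𝓡∂ 4) G y → (∀ y', Literature.Topology.FourManifolds.LefschetzBase.rho g (G y').1 = 1 / 4) → (∀ᶠ y' in nhds y, ∃ r : ℝ, 0 < r ∧ Literature.Topology.FourManifolds.LefschetzBase.w g (G y').1 = (r : ℂ) * Literature.Topology.FourManifolds.LefschetzBase.w g y'.1.1) → ‖Literature.Topology.FourManifolds.LefschetzBase.cx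 y.1.1‖ ^ 2 < 4 → ‖Literature.Topology.FourManifolds.LefschetzBase.cx (G y).1‖ ^ 2 < 4 → Literature.Topology.FourManifolds.LefschetzBase.w g y.1.1 ≠ 0 → (∀ X : EuclideanSpace ℝ (Fin 4), fderiv ℝ (Literature.Topology.FourManifolds.LefschetzBase.rho g) (G y).1 (Summit.SmoothPoincare4.SmoothPoincare4.Theorems.AcyclicBisectionExists.ModpBraidOrbits.bdDeriv g G y X) = 0) ∧ (∃ κ : ℝ, 0 < κ ∧ ∀ X : EuclideanSpace ℝ (Fin 4), fderiv ℝ (Literature.Topology.FourManifolds.LefschetzBase.rho g) y.1.1 X = 0 → inner ℝ (Summit.SmoothPoincare4.SmoothPoincare4.Theorems.AcyclicBisectionExists.ModpBraidOrbits.bdDeriv g G y X) (Literature.Topology.FourManifolds.LefschetzBase.horizNormal g (G y).1) = κ * inner ℝ X (Literature.Topology.FourManifolds.LefschetzBase.horizNormal g y.1.1)) ∧ (∀ X : EuclideanSpace ℝ (Fin 4), Literature.Topology.FourManifolds.LefschetzBase.dPhiX g y.1.1 * Literature.Topology.FourManifolds.LefschetzBase.cx X + Literature.Topology.FourManifolds.LefschetzBase.dPhiY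 y.1.1 * Literature.Topology.FourManifolds.LefschetzBase.cy X = 0 → Literature.Topology.FourManifolds.LefschetzBase.dPhiX g (G y).1 * Literature.Topology.FourManifolds.LefschetzBase.cx (Summit.SmoothPoincare4.SmoothPoincare4.Theorems.AcyclicBisectionExists.ModpBraidOrbits.bdDeriv g G y X) + Literature.Topology.FourManifolds.LefschetzBase.dPhiY (G y).1 * Literature.Topology.FourManifolds.LefschetzBase.cy (Summit.SmoothPoincare4.SmoothPoincare4.Theorems.AcyclicBisectionExists.ModpBraidOrbits.bdDeriv g G y X) = 0) := by
  intro g G y hG hbd hdir hflat hflat' hw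
  obtain ⟨r, hr, hrw, hang⟩ := angle_bdDeriv hG hdir
  have hρ := fderiv_rho_bdDeriv hG hbd
  have hw' : w g (G y).1 ≠ 0 := by
    rw [hrw]; exact mul_ne_zero (by exact_mod_cast hr.ne') hw
  have hq : (y.1.1 : EuclideanSpace ℝ (Fin 4)) ≠ 0 := coe_ne_zero y.1
  have hq' : ((G y).1 : EuclideanSpace ℝ (Fin 4)) ≠ 0 := coe_ne_zero (G y)
  have hN : 0 < ‖dPhiX g y.1.1‖ ^ 2 + ‖dPhiY y.1.1‖ ^ 2 :=
    lt_of_le_of_ne (by positivity) (Ne.symm (normSq_dPhi_ne_zero hq))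
  have hN' : 0 < ‖dPhiX g (G y).1‖ ^ 2 + ‖dPhiY (G y).1‖ ^ 2 :=
    lt_of_le_of_ne (by positivity) (Ne.symm (normSq_dPhi_ne_zero hq'))
  refine ⟨hρ, ⟨r ^ 2 * ((‖dPhiX g y.1.1‖ ^ 2 + ‖dPhiY y.1.1‖ ^ 2) /
    (‖dPhiX g (G y).1‖ ^ 2 + ‖dPhiY (G y).1‖ ^ 2)), by positivity, fun X hX => ?_⟩, fun X hX => ?_⟩
  · rw [inner_horizNormal, inner_horizNormal, hang X hX]
    field_simp
  · have hρX : fderiv ℝ (rho g) y.1.1 X = 0 := by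
      rw [fderiv_rho_apply_of_flat hflat, hX, mul_zero, Complex.zero_re, mul_zero]
    have hre' : (conj (w g (G y).1) * (dPhiX g (G y).1 * cx (bdDeriv g G y X) +
        dPhiY (G y).1 * cy (bdDeriv g G y X))).re = 0 := by
      have h1 := hρ X
      rw [fderiv_rho_apply_of_flat hflat'] at h1
      linarith
    have him' : (conj (w g (G y).1) * (dPhiX g (G y).1 * cx (bdDeriv g G y X) +
        dPhiY (G y).1 * cy (bdDeriv g G y X))).im = 0 := by
      rw [hang X hρX, hX, mul_zero, Complex.zero_im, mul_zero]
    have hprod : conj (w g (G y).1) * (dPhiX g (G y).1 * cx (bdDeriv g G y X) +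
        dPhiY (G y).1 * cy (bdDeriv g G y X)) = 0 :=
      Complex.ext (by rw [hre', Complex.zero_re]) (by rw [him', Complex.zero_im])
    exact (mul_eq_zero.1 hprod).resolve_left ((map_ne_zero _).2 hw')

/-! ## §3 The seam map has injective differential -/

section Seam

variable {ι : Type} [Finite ι] {h : ι → HandleAttachingMap 3 2 (Base g)}
  {X : Type} [TopologicalSpace X] [ChartedSpace (EuclideanHalfSpace 4) X] [IsManifold (𝓡∂ 4) ∞ X]
  (D : MultiAttachmentData h (𝓡∂ 4) X) (bX : BoundaryData (𝓡∂ 4) X (𝓡 3)) [Nonempty bX.carrier]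
  (Ψ : bX.carrier ≃ₘ⟮𝓡 3, 𝓡 3⟯ (bBase g).carrier)

/-- **The seam map `seamB` has injective differential off the cores** (`seamLift` has, `Ψ` is a
diffeomorphism, the boundary inclusion is an immersion). [cite: LeeSmoothManifolds2013, Cor. 5.30] -/
theorem injective_mfderiv_seamB {y : (bBase g).carrier} (hy : (y.1 : Base g) ∈ coresComplement h) :
    Injective (mfderiv (𝓡 3) (𝓡∂ 4) (seamB D bX Ψ) y) := by
  have hsl : MDifferentiableAt (𝓡 3) (𝓡 3) (seamLift D bX Ψ) y :=
    (contMDiffAt_seamLift D bX Ψ hy).mdifferentiableAt (by simp)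
  have hΨ : MDifferentiableAt (𝓡 3) (𝓡 3) Ψ (seamLift D bX Ψ y) := Ψ.contMDiff.mdifferentiableAt (by simp)
  have hincl : MDifferentiableAt (𝓡 3) (𝓡∂ 4) (bBase g).incl (Ψ (seamLift D bX Ψ y)) :=
    (bBase g).isSmoothEmbedding.contMDiff.mdifferentiableAt (by simp)
  have e : seamB D bX Ψ = (bBase g).incl ∘ (Ψ ∘ seamLift D bX Ψ) := rfl
  rw [e, mfderiv_comp y hincl (hΨ.comp y hsl), mfderiv_comp y hΨ hsl]
  have h1 : Injective (mfderiv (𝓡 3) (𝓡∂ 4) (bBase g).incl (Ψ (seamLift D bX Ψ y))) :=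
    injective_mfderiv_boundaryIncl (bBase g) _
  have h2 : Injective (mfderiv (𝓡 3) (𝓡 3) Ψ (seamLift D bX Ψ y)) :=
    (Ψ.mfderivToContinuousLinearEquiv (by simp) (seamLift D bX Ψ y)).injective
  exact h1.comp (h2.comp (injective_mfderiv_seamLift D bX Ψ hy))

/-- The page clause holds near every point off the cores (the domain is open). [folklore] -/
theorem eventually_w_seamB
    (hpage : ∀ (y : bX.carrier) (a : ↥(coresComplement h)), bX.incl y = D.jA a →
      ∃ c : ℝ, 0 < c ∧ w g ((bBase g).incl (Ψ y)).1 = (c : ℂ) * w g (a : Base g).1)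
    {y : (bBase g).carrier} (hy : (y.1 : Base g) ∈ coresComplement h) :
    ∀ᶠ y' in 𝓝 y, ∃ r : ℝ, 0 < r ∧ w g (seamB D bX Ψ y').1 = (r : ℂ) * w g y'.1.1 := by
  filter_upwards [isOpen_seamDom.mem_nhds hy] with y' hy'
  exact w_seamB D bX Ψ hpage hy'

/-- The page clause composed with a direction-preserving map of the base. [folklore] -/
theorem eventually_w_comp_seamB {f : Base g → Base g}
    (hf : ∀ x : Base g, ∃ r : ℝ, 0 < r ∧ w g (f x).1 = (r : ℂ) * w g x.1)
    (hpage : ∀ (y : bX.carrier) (a : ↥(coresComplement h)), bX.incl y = D.jA a →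
      ∃ c : ℝ, 0 < c ∧ w g ((bBase g).incl (Ψ y)).1 = (c : ℂ) * w g (a : Base g).1)
    {y : (bBase g).carrier} (hy : (y.1 : Base g) ∈ coresComplement h) :
    ∀ᶠ y' in 𝓝 y, ∃ r : ℝ, 0 < r ∧ w g ((f ∘ seamB D bX Ψ) y').1 = (r : ℂ) * w g y'.1.1 := by
  filter_upwards [eventually_w_seamB D bX Ψ hpage hy] with y' hy'
  obtain ⟨r₁, hr₁, h₁⟩ := hy'
  obtain ⟨r₂, hr₂, h₂⟩ := hf (seamB D bX Ψ y')
  refine ⟨r₂ * r₁, mul_pos hr₂ hr₁, ?_⟩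
  rw [Function.comp_apply, h₂, h₁]; push_cast; ring

end Seam

end Summit.SmoothPoincare4.SmoothPoincare4.Theorems.AcyclicBisectionExists.ModpBraidOrbits

end
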